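/-
Copyright: public-audit package `pub-balaban` (b2b-balaban), seat pv09-g4. Released under Apache 2.0 like Mathlib.
-/
import Literature.MathematicalPhysics.QuantumFieldTheory.Balaban1983to89.B6FaceInterpolation

/-!
# B6, (2.125): the averaging lower bound |(Q₁B)(c)|² ≥ ⅓|Σ_{x∈Δ′} L^{−d}B_μ(x)|² − … on the concrete carrier

Source under audit: T. Bałaban, *Propagators and renormalization transformations for lattice gauge theories.
II*, Commun. Math. Phys. **96** (1984) 223–250 [B6], proof of Lemma 2.4, p. 245.  Companion of
`B6TreeGaugePoincare` ((2.123)), `B6FaceInterpolation` ((2.124)) and `B6LayerPoincare` (the p.245 sentence,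
repaired); the blocks B(y) (`block`), the μ-bonds ⟨x, x + e_μ⟩ ⊂ B(y) (`bondStarts L y μ`) and the layer Δ′
(`lastLayer L y μ`) are taken from there.

## Text (verbatim, p. 245, display (2.125))

*"|(Q₁B)(c)|² = |Σ_{x∈B(c₋)} L^{−(d+1)} B([x, x + Le_μ])|² = |L^{−d} Σ_{x∈B(y)∖Δ′} L^{−1}(x_μ − y_μ + 1)B_μ(x)
+ L^{−d} Σ_{x∈Δ′} B_μ(x) + L^{−d} Σ_{x∈B(y+Le_μ)} L^{−1}(2L − 1 + y_μ − x_μ)B_μ(x)|²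
≦ ⅓ |Σ_{x∈Δ′} L^{−d}B_μ(x)|² − L^{−d} Σ_{⟨x,x+e_μ⟩⊂B(c₋)} |B_μ(x)|² − L^{−d} Σ_{⟨x,x+e_μ⟩⊂B(c₊)} |B_μ(x)|². (2.125)"*

Here c = ⟨y, y + Le_μ⟩, c₋ = y, c₊ = y + Le_μ, B([x, x + Le_μ]) = Σ_{t=0}^{L−1} B(x + te_μ, x + (t+1)e_μ) (the
contour sum of (2.120), B5 (1.11)), and *"We identify B(b) = B_μ(x) for b = ⟨x, x + e_μ⟩"* (p. 245).  The printed
relation sign "≦" is a slip for "≧" (package DIVERGENCE D-r1.7: the display is used as a LOWER bound in the next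
line, *"From these two inequalities we obtain"* (2.126)); this file proves the display with "≥".

## What this file proves

`ineq2125`: for every L ≥ 1, y ∈ ℤ^d, μ and every bond configuration B,

  ⅓ (Σ_{x∈Δ′} L^{−d} B_μ(x))² − L^{−d} Σ_{⟨x,x+e_μ⟩⊂B(y)} B_μ(x)² − L^{−d} Σ_{⟨x,x+e_μ⟩⊂B(y+Le_μ)} B_μ(x)²
    ≤ (Σ_{x∈B(y)} L^{−(d+1)} Σ_{t<L} B(x + te_μ, μ))²,

whose right-hand side is literally the summand `q1Term L B (y, μ)` of the concrete carrier
(`B6Lemma24Carrier`), i.e. |(Q₁B)(c)|².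

## Proof

Regroup the contour sums by bonds (`contourSum_eq`): Σ_{x∈B(y)} Σ_{t<L} B_μ(x + te_μ) = Σ_z n(z) B_μ(z), n(z) =
#{(x, t) : x ∈ B(y), t < L, x + te_μ = z}.  Only two facts about the multiplicities are needed and proved:
n(z) ≤ L for all z (`count_le`: t determines x) and n(z) = L for z ∈ Δ′ (`count_eq`); the exact printed weights
x_μ − y_μ + 1 and 2L − 1 + y_μ − x_μ are NOT needed for the inequality and are not computed.  The z with n(z) ≠ 0
other than Δ′ start μ-bonds ⊂ B(y) (`zoneLow_subset`) or ⊂ B(y + Le_μ) (`zoneHigh_subset`).  Hence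
L^{−(d+1)} × (contour sum) = v + u + w with u = L^{−d} Σ_{Δ′} B_μ, and by Cauchy–Schwarz (`weighted_sq_le`) and
#{μ-bonds ⊂ B(y)} ≤ L^d: v² ≤ L^{−2d−2} · L^d · L² Σ_{⊂B(y)} B_μ² = L^{−d} Σ_{⊂B(y)} B_μ², likewise w; finally
(v + u + w)² ≥ ⅓u² − v² − w² (`sq_third_le'`).

## HONEST SCOPE

Only the inequality of (2.125) (with the intended sign) is proved, for the concrete objects of the tree; the middle
expression of the display (the explicit weights) is quoted, not formalised.  (2.126), (2.127) and the summation
over faces are not in this file.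
-/

open Finset

namespace Literature.MathematicalPhysics.QuantumFieldTheory.Balaban1983to89.B6AveragingBound

open B6Elimination (block mem_block card_block)
open B6BondElimination (unitVec unitVec_apply add_smul_unitVec_apply sub_smul_unitVec_apply)
open B6TreeGaugePoincare (Cfg bondStarts mem_bondStarts)
open B6FaceInterpolation (lastLayer mem_lastLayer)

noncomputable section

variable {d : ℕ} {L : ℕ}

/-! ## §1  The contours [x, x + Le_μ], x ∈ B(y), regrouped by bonds -/

/-- The pairs (x, t), x ∈ B(y), t < L: the t-th bond ⟨x + te_μ, x + (t+1)e_μ⟩ of the contour [x, x + Le_μ].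
[cite: Balaban1984PropagatorsII, (2.120)] -/
def contourPairs (L : ℕ) (y : Fin d → ℤ) : Finset ((Fin d → ℤ) × ℕ) := block L y ×ˢ range L

/-- The starting point x + te_μ of the t-th bond of the contour of x. [folklore] -/
def bondOf (μ : Fin d) (p : (Fin d → ℤ) × ℕ) : Fin d → ℤ := p.1 + (p.2 : ℤ) • unitVec μ

/-- The starting points of all bonds on the contours [x, x + Le_μ], x ∈ B(y). [folklore] -/
def contourImage (L : ℕ) (y : Fin d → ℤ) (μ : Fin d) : Finset (Fin d → ℤ) :=
  (contourPairs L y).image (bondOf μ)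

/-- The contours through the bond starting at z. [folklore] -/
def fiber (L : ℕ) (y : Fin d → ℤ) (μ : Fin d) (z : Fin d → ℤ) : Finset ((Fin d → ℤ) × ℕ) :=
  (contourPairs L y).filter fun p => bondOf μ p = z

/-- n(z) = the number of contours [x, x + Le_μ], x ∈ B(y), containing the bond ⟨z, z + e_μ⟩. [folklore] -/
def count (L : ℕ) (y : Fin d → ℤ) (μ : Fin d) (z : Fin d → ℤ) : ℕ := #(fiber L y μ z)

/-- Regrouping the contour sums by bonds: Σ_{x∈B(y)} Σ_{t<L} B_μ(x + te_μ) = Σ_z n(z) B_μ(z) — the second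
equality sign of (2.125), with the multiplicities left as counts. [cite: Balaban1984PropagatorsII, (2.125)] -/
theorem contourSum_eq (y : Fin d → ℤ) (μ : Fin d) (B : Cfg d) :
    ∑ x ∈ block L y, ∑ t ∈ range L, B (x + (t : ℤ) • unitVec μ, μ) =
      ∑ z ∈ contourImage L y μ, (count L y μ z : ℝ) * B (z, μ) := by
  classical
  have h1 : ∑ x ∈ block L y, ∑ t ∈ range L, B (x + (t : ℤ) • unitVec μ, μ) =
      ∑ p ∈ contourPairs L y, B (bondOf μ p, μ) := by
    rw [contourPairs, sum_product]
    rfl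
  have h2 : ∑ z ∈ contourImage L y μ, ∑ p ∈ (contourPairs L y).filter (fun p => bondOf μ p = z),
      B (bondOf μ p, μ) = ∑ p ∈ contourPairs L y, B (bondOf μ p, μ) :=
    sum_fiberwise_of_maps_to (fun p hp => mem_image_of_mem _ hp) _
  rw [h1, ← h2]
  refine sum_congr rfl fun z _ => ?_
  rw [show ∑ p ∈ (contourPairs L y).filter (fun p => bondOf μ p = z), B (bondOf μ p, μ) =
      ∑ p ∈ (contourPairs L y).filter (fun p => bondOf μ p = z), B (z, μ) from
    sum_congr rfl fun p hp => by rw [(mem_filter.1 hp).2], sum_const, nsmul_eq_mul]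
  rfl

/-- n(z) ≤ L: on a contour the bond starting at z has position t with x = z − te_μ, so t < L determines the
contour. [folklore] -/
theorem count_le (y : Fin d → ℤ) (μ : Fin d) (z : Fin d → ℤ) : count L y μ z ≤ L := by
  classical
  calc #(fiber L y μ z) ≤ #(range L) :=
        card_le_card_of_injOn (fun p => p.2) (fun p hp => (mem_product.1 (mem_filter.1 hp).1).2)
          (fun p hp p' hp' h => by
            have e1 := (mem_filter.1 (mem_coe.1 hp)).2
            have e2 := (mem_filter.1 (mem_coe.1 hp')).2
            simp only [bondOf] at e1 e2
            refine Prod.ext ?_ h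
            rw [eq_sub_of_add_eq e1, eq_sub_of_add_eq e2]
            simp only at h
            rw [h])
    _ = L := card_range L

/-- n(z) = L for z ∈ Δ′: every contour of the line through z passes through the crossing bond ⟨z, z + e_μ⟩
(x = z − te_μ ∈ B(y) for all t < L). [cite: Balaban1984PropagatorsII, (2.125)] -/
theorem count_eq {y : Fin d → ℤ} {μ : Fin d} {z : Fin d → ℤ} (hz : z ∈ lastLayer L y μ) :
    count L y μ z = L := by
  classical
  refine le_antisymm (count_le y μ z) ?_
  obtain ⟨hzb, hzμ⟩ := mem_lastLayer.1 hz
  have hb := mem_block.1 hzb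
  set ψ : ℕ → (Fin d → ℤ) × ℕ := fun t => (z - (t : ℤ) • unitVec μ, t) with hψ
  have hinj : Set.InjOn ψ ↑(range L) := fun t _ t' _ h => by
    have := congr_arg Prod.snd h
    simpa [hψ] using this
  calc L = #(range L) := (card_range L).symm
    _ = #((range L).image ψ) := (card_image_of_injOn hinj).symm
    _ ≤ #(fiber L y μ z) := card_le_card fun p hp => by
        obtain ⟨t, ht, rfl⟩ := mem_image.1 hp
        have ht' := mem_range.1 ht
        refine mem_filter.2 ⟨mem_product.2 ⟨mem_block.2 fun i => ?_, ht⟩, ?_⟩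
        · simp only [hψ]
          rw [sub_smul_unitVec_apply]
          have := hb i
          by_cases h : i = μ
          · rw [if_pos h, h]; rw [h] at this; omega
          · rw [if_neg h]; omega
        · simp only [hψ, bondOf]
          exact sub_add_cancel z _

/-- Coordinates of a point of a contour: transversally inside B(y), and y_μ ≤ z_μ ≤ y_μ + 2L − 2. [folklore] -/
theorem contourImage_coords {y : Fin d → ℤ} {μ : Fin d} {z : Fin d → ℤ} (hz : z ∈ contourImage L y μ) :
    (∀ i, i ≠ μ → y i ≤ z i ∧ z i < y i + L) ∧ y μ ≤ z μ ∧ z μ + 2 ≤ y μ + 2 * L := by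
  obtain ⟨p, hp, rfl⟩ := mem_image.1 hz
  obtain ⟨hx, ht⟩ := mem_product.1 hp
  have hb := mem_block.1 hx
  have ht' : p.2 < L := mem_range.1 ht
  have ht'' : (p.2 : ℤ) + 1 ≤ (L : ℤ) := by exact_mod_cast ht'
  refine ⟨fun i hi => ?_, ?_⟩
  · have := hb i
    simp only [bondOf, add_smul_unitVec_apply, if_neg hi, add_zero]
    exact this
  · have := hb μ
    simp only [bondOf, add_smul_unitVec_apply]
    constructor <;> omega

/-- Δ′ lies on the contours (t = 0). [folklore] -/
theorem lastLayer_subset_contourImage (hL : 1 ≤ L) (y : Fin d → ℤ) (μ : Fin d) :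
    lastLayer L y μ ⊆ contourImage L y μ := fun z hz => by
  classical
  refine mem_image.2 ⟨(z, 0), mem_product.2 ⟨(mem_lastLayer.1 hz).1, mem_range.2 (by omega)⟩, ?_⟩
  simp [bondOf]

/-! ## §2  The three zones: μ-bonds ⊂ B(y), the crossing bonds (Δ′), μ-bonds ⊂ B(y + Le_μ) -/

/-- Contour bonds ⟨z, z + e_μ⟩ ⊂ B(y) (z_μ + 1 < y_μ + L). [folklore] -/
def zoneLow (L : ℕ) (y : Fin d → ℤ) (μ : Fin d) : Finset (Fin d → ℤ) :=
  (contourImage L y μ).filter fun z => z μ + 1 < y μ + L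

/-- Contour bonds not inside B(y). [folklore] -/
def zoneRest (L : ℕ) (y : Fin d → ℤ) (μ : Fin d) : Finset (Fin d → ℤ) :=
  (contourImage L y μ).filter fun z => ¬ z μ + 1 < y μ + L

/-- The crossing bonds: z ∈ Δ′ (z_μ + 1 = y_μ + L). [folklore] -/
def zoneMid (L : ℕ) (y : Fin d → ℤ) (μ : Fin d) : Finset (Fin d → ℤ) :=
  (zoneRest L y μ).filter fun z => z μ + 1 = y μ + L

/-- Contour bonds ⊂ B(y + Le_μ) (z_μ ≥ y_μ + L). [folklore] -/
def zoneHigh (L : ℕ) (y : Fin d → ℤ) (μ : Fin d) : Finset (Fin d → ℤ) :=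
  (zoneRest L y μ).filter fun z => ¬ z μ + 1 = y μ + L

/-- Σ over the contour bonds = Σ over the three zones. [folklore] -/
theorem sum_zones (y : Fin d → ℤ) (μ : Fin d) (F : (Fin d → ℤ) → ℝ) :
    ∑ z ∈ contourImage L y μ, F z =
      ∑ z ∈ zoneLow L y μ, F z + ∑ z ∈ zoneMid L y μ, F z + ∑ z ∈ zoneHigh L y μ, F z := by
  rw [zoneLow, zoneMid, zoneHigh, zoneRest, add_assoc, sum_filter_add_sum_filter_not,
    sum_filter_add_sum_filter_not]

/-- The middle zone is exactly Δ′. [folklore] -/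
theorem zoneMid_eq (hL : 1 ≤ L) (y : Fin d → ℤ) (μ : Fin d) : zoneMid L y μ = lastLayer L y μ := by
  ext z
  simp only [zoneMid, zoneRest, mem_filter]
  constructor
  · rintro ⟨⟨hz, -⟩, hzμ⟩
    obtain ⟨hoff, -, -⟩ := contourImage_coords hz
    refine mem_lastLayer.2 ⟨mem_block.2 fun i => ?_, by omega⟩
    by_cases h : i = μ
    · rw [h]; omega
    · exact hoff i h
  · intro hz
    have hzμ := (mem_lastLayer.1 hz).2
    exact ⟨⟨lastLayer_subset_contourImage hL y μ hz, by omega⟩, by omega⟩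

/-- The low zone consists of μ-bonds ⊂ B(y). [folklore] -/
theorem zoneLow_subset (y : Fin d → ℤ) (μ : Fin d) : zoneLow L y μ ⊆ bondStarts L y μ := fun z hz => by
  obtain ⟨hz, hzμ⟩ := mem_filter.1 hz
  obtain ⟨hoff, hμ1, -⟩ := contourImage_coords hz
  refine mem_bondStarts.2 ⟨mem_block.2 fun i => ?_, hzμ⟩
  by_cases h : i = μ
  · rw [h]; omega
  · exact hoff i h

/-- The high zone consists of μ-bonds ⊂ B(y + Le_μ). [folklore] -/
theorem zoneHigh_subset (y : Fin d → ℤ) (μ : Fin d) :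
    zoneHigh L y μ ⊆ bondStarts L (y + (L : ℤ) • unitVec μ) μ := fun z hz => by
  simp only [zoneHigh, zoneRest, mem_filter] at hz
  obtain ⟨⟨hz, h1⟩, h2⟩ := hz
  obtain ⟨hoff, -, hμ2⟩ := contourImage_coords hz
  refine mem_bondStarts.2 ⟨mem_block.2 fun i => ?_, ?_⟩
  · rw [add_smul_unitVec_apply]
    by_cases h : i = μ
    · rw [if_pos h, h]; omega
    · rw [if_neg h, add_zero]; exact hoff i h
  · rw [add_smul_unitVec_apply, if_pos rfl]; omega

/-! ## §3  Cauchy–Schwarz for the two side zones -/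

/-- (Σ_{z∈Z} n(z) f(z))² ≤ #T · L² · Σ_{z∈T} f(z)² for Z ⊆ T and multiplicities n ≤ L on Z. [folklore] -/
theorem weighted_sq_le {Z T : Finset (Fin d → ℤ)} (hZT : Z ⊆ T) (n : (Fin d → ℤ) → ℕ)
    (hn : ∀ z ∈ Z, n z ≤ L) (f : (Fin d → ℤ) → ℝ) :
    (∑ z ∈ Z, (n z : ℝ) * f z) ^ 2 ≤ (#T : ℝ) * (L : ℝ) ^ 2 * ∑ z ∈ T, f z ^ 2 := by
  have hcs := sum_mul_sq_le_sq_mul_sq Z (fun z => (n z : ℝ)) f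
  have h1 : ∑ z ∈ Z, (n z : ℝ) ^ 2 ≤ (#T : ℝ) * (L : ℝ) ^ 2 := by
    calc ∑ z ∈ Z, (n z : ℝ) ^ 2 ≤ ∑ z ∈ Z, (L : ℝ) ^ 2 := sum_le_sum fun z hz => by
            have h0 : (0 : ℝ) ≤ n z := Nat.cast_nonneg _
            have hL' : (n z : ℝ) ≤ L := by exact_mod_cast hn z hz
            nlinarith
      _ = (#Z : ℝ) * (L : ℝ) ^ 2 := by rw [sum_const, nsmul_eq_mul]
      _ ≤ (#T : ℝ) * (L : ℝ) ^ 2 :=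
          mul_le_mul_of_nonneg_right (by exact_mod_cast card_le_card hZT) (sq_nonneg _)
  have h2 : ∑ z ∈ Z, f z ^ 2 ≤ ∑ z ∈ T, f z ^ 2 :=
    sum_le_sum_of_subset_of_nonneg hZT fun _ _ _ => sq_nonneg _
  calc (∑ z ∈ Z, (n z : ℝ) * f z) ^ 2 ≤ (∑ z ∈ Z, (n z : ℝ) ^ 2) * ∑ z ∈ Z, f z ^ 2 := hcs
    _ ≤ (#T : ℝ) * (L : ℝ) ^ 2 * ∑ z ∈ T, f z ^ 2 :=
        mul_le_mul h1 h2 (sum_nonneg fun _ _ => sq_nonneg _) (by positivity)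

/-- There are at most L^d bonds ⟨x, x + e_μ⟩ ⊂ B(y) (in fact (L − 1)L^{d−1}). [folklore] -/
theorem card_bondStarts_le (y : Fin d → ℤ) (μ : Fin d) : #(bondStarts L y μ) ≤ L ^ d :=
  (card_filter_le _ _).trans (card_block y).le

/-- The side-zone bound: (Σ_{z∈Z} n(z) B_μ(z))² ≤ L^d · L² · Σ_{⟨x,x+e_μ⟩⊂B(y′)} B_μ(x)² for a zone Z of
μ-bonds ⊂ B(y′). [folklore] -/
theorem zone_sq_le {Z : Finset (Fin d → ℤ)} {y' : Fin d → ℤ} {μ : Fin d} (hZ : Z ⊆ bondStarts L y' μ)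
    (y : Fin d → ℤ) (B : Cfg d) :
    (∑ z ∈ Z, (count L y μ z : ℝ) * B (z, μ)) ^ 2 ≤
      (L : ℝ) ^ d * (L : ℝ) ^ 2 * ∑ x ∈ bondStarts L y' μ, B (x, μ) ^ 2 := by
  have h := weighted_sq_le hZ (count L y μ) (fun z _ => count_le y μ z) (fun z => B (z, μ))
  refine le_trans h (mul_le_mul_of_nonneg_right (mul_le_mul_of_nonneg_right ?_ (sq_nonneg _))
    (sum_nonneg fun _ _ => sq_nonneg _))
  exact_mod_cast card_bondStarts_le y' μ

/-- (v + u + w)² ≥ ⅓u² − v² − w² (since u² = ((v+u+w) − v − w)² ≤ 3((v+u+w)² + v² + w²)). [folklore] -/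
theorem sq_third_le' (u v w : ℝ) : u ^ 2 / 3 - v ^ 2 - w ^ 2 ≤ (v + u + w) ^ 2 := by
  nlinarith [sq_nonneg (v + u + w + v), sq_nonneg (v + u + w + w), sq_nonneg (v - w)]

/-! ## §4  (2.125) -/

/-- **B6 (2.125), with the intended sign, on the concrete carrier.**  For L ≥ 1, c = ⟨y, y + Le_μ⟩ and every B:
⅓ (Σ_{x∈Δ′} L^{−d} B_μ(x))² − L^{−d} Σ_{⟨x,x+e_μ⟩⊂B(c₋)} B_μ(x)² − L^{−d} Σ_{⟨x,x+e_μ⟩⊂B(c₊)} B_μ(x)²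
≤ |(Q₁B)(c)|² = (Σ_{x∈B(y)} L^{−(d+1)} Σ_{t<L} B(x + te_μ, μ))² (the right-hand side is the summand
`B6Lemma24Carrier.q1Term L B (y, μ)`).  The printed "≦" is the slip D-r1.7. [cite: Balaban1984PropagatorsII, (2.125)] -/
theorem ineq2125 (hL : 1 ≤ L) (y : Fin d → ℤ) (μ : Fin d) (B : Cfg d) :
    (1 / 3 : ℝ) * (∑ x ∈ lastLayer L y μ, ((L : ℝ)⁻¹) ^ d * B (x, μ)) ^ 2
      - ((L : ℝ)⁻¹) ^ d * ∑ x ∈ bondStarts L y μ, B (x, μ) ^ 2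
      - ((L : ℝ)⁻¹) ^ d * ∑ x ∈ bondStarts L (y + (L : ℤ) • unitVec μ) μ, B (x, μ) ^ 2 ≤
    (∑ x ∈ block L y, ((L : ℝ)⁻¹) ^ (d + 1) * ∑ t ∈ range L, B (x + (t : ℤ) • unitVec μ, μ)) ^ 2 := by
  classical
  have hL0 : (0 : ℝ) < L := by exact_mod_cast (Nat.lt_of_lt_of_le Nat.zero_lt_one hL)
  have hne : (L : ℝ) ≠ 0 := hL0.ne'
  set ℓ : ℝ := (L : ℝ)⁻¹ with hℓ
  set U : ℝ := ∑ x ∈ lastLayer L y μ, B (x, μ) with hU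
  set P1 : ℝ := ∑ z ∈ zoneLow L y μ, (count L y μ z : ℝ) * B (z, μ) with hP1
  set P3 : ℝ := ∑ z ∈ zoneHigh L y μ, (count L y μ z : ℝ) * B (z, μ) with hP3
  set Nm : ℝ := ∑ x ∈ bondStarts L y μ, B (x, μ) ^ 2 with hNm
  set Np : ℝ := ∑ x ∈ bondStarts L (y + (L : ℤ) • unitVec μ) μ, B (x, μ) ^ 2 with hNp
  -- the contour sum, regrouped and split into the three zones
  have hS : ∑ x ∈ block L y, ∑ t ∈ range L, B (x + (t : ℤ) • unitVec μ, μ) = P1 + (L : ℝ) * U + P3 := by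
    rw [contourSum_eq, sum_zones, zoneMid_eq hL]
    have h2 : ∑ z ∈ lastLayer L y μ, (count L y μ z : ℝ) * B (z, μ) = (L : ℝ) * U := by
      rw [hU, mul_sum]
      exact sum_congr rfl fun z hz => by rw [count_eq hz]
    rw [h2]
  have hu : ∑ x ∈ lastLayer L y μ, ℓ ^ d * B (x, μ) = ℓ ^ d * U := by rw [hU, mul_sum]
  have hq : ∑ x ∈ block L y, ℓ ^ (d + 1) * ∑ t ∈ range L, B (x + (t : ℤ) • unitVec μ, μ) =
      ℓ ^ (d + 1) * (P1 + (L : ℝ) * U + P3) := by rw [← hS, mul_sum]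
  have hℓL : ℓ ^ (d + 1) * (L : ℝ) = ℓ ^ d := by
    rw [hℓ, pow_succ, mul_assoc, inv_mul_cancel₀ hne, mul_one]
  have he : ℓ ^ (d + 1) * (P1 + (L : ℝ) * U + P3) = ℓ ^ (d + 1) * P1 + ℓ ^ d * U + ℓ ^ (d + 1) * P3 := by
    calc ℓ ^ (d + 1) * (P1 + (L : ℝ) * U + P3)
        = ℓ ^ (d + 1) * P1 + (ℓ ^ (d + 1) * (L : ℝ)) * U + ℓ ^ (d + 1) * P3 := by ring
      _ = _ := by rw [hℓL]
  -- Cauchy–Schwarz for the side zones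
  have hpow : (ℓ ^ (d + 1)) ^ 2 * ((L : ℝ) ^ d * (L : ℝ) ^ 2) = ℓ ^ d := by
    rw [hℓ]
    simp only [inv_pow]
    field_simp
    ring
  have hℓ0 : 0 ≤ (ℓ ^ (d + 1)) ^ 2 := sq_nonneg _
  have hv : (ℓ ^ (d + 1) * P1) ^ 2 ≤ ℓ ^ d * Nm := by
    have h := zone_sq_le (zoneLow_subset (L := L) y μ) y B
    calc (ℓ ^ (d + 1) * P1) ^ 2 = (ℓ ^ (d + 1)) ^ 2 * P1 ^ 2 := by ring
      _ ≤ (ℓ ^ (d + 1)) ^ 2 * ((L : ℝ) ^ d * (L : ℝ) ^ 2 * Nm) := mul_le_mul_of_nonneg_left h hℓ0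
      _ = ℓ ^ d * Nm := by rw [← hpow]; ring
  have hw : (ℓ ^ (d + 1) * P3) ^ 2 ≤ ℓ ^ d * Np := by
    have h := zone_sq_le (zoneHigh_subset (L := L) y μ) y B
    calc (ℓ ^ (d + 1) * P3) ^ 2 = (ℓ ^ (d + 1)) ^ 2 * P3 ^ 2 := by ring
      _ ≤ (ℓ ^ (d + 1)) ^ 2 * ((L : ℝ) ^ d * (L : ℝ) ^ 2 * Np) := mul_le_mul_of_nonneg_left h hℓ0
      _ = ℓ ^ d * Np := by rw [← hpow]; ring
  rw [hu, hq, he]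
  linarith [sq_third_le' (ℓ ^ d * U) (ℓ ^ (d + 1) * P1) (ℓ ^ (d + 1) * P3), hv, hw]

end

end Literature.MathematicalPhysics.QuantumFieldTheory.Balaban1983to89.B6AveragingBound
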